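import Literature.NumberTheory.EllipticCurves.BhargavaShankarSievePhiRegularityProofs
import Mathlib.MeasureTheory.Function.L1Space.Integrable
import HarnessLib

/-!
# The local sieve weight `φ_p` of Bhargava–Shankar is (a.e.) measurable and integrable on `V_{ℤ_p}`

`Proofs` companion (theorems only: no definitions, no named facts) of
`BhargavaShankarSievePhiRegularityProofs.lean` (`φ_p(f) = 1/m_p(f)` for `ℚ_p`-soluble `f` with
`(I(f), J(f)) ∈ 2⁴F_p^{inv} × 2⁶F_p^{inv}`, `0` otherwise, is locally constant off `Δ = 0`) and
`BinaryQuarticMeasure.lean` (the Borel structure and the normalised Haar measure `μ_p = volume` on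
`V_{ℤ_p}`; `{Δ = 0}` is null). Source: M. Bhargava, A. Shankar, Ann. of Math. (2) 181 (2015),
§2.7 (acceptable functions are integrated against `df`) and the proof of Thm 3.19 of the published
version (`∫_{V_{ℤ_p}} φ_p(f) df` is evaluated by Props 3.6, 3.9). The integrals `∫ φ_p dμ_p` that
enter Thm 2.21 presuppose that `φ_p` is (a.e.) measurable; since `φ_p` is locally constant on the
open set `{Δ ≠ 0}` of full measure, this holds:

* `measurable_ite_disc_localWeight` — `f ↦ m_p(f)` (set to `0` on `{Δ = 0}`) is measurable;
* `measurableSet_setOf_isSoluble`, `measurableSet_setOf_exists_invariantPairsAdic` — the solubility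
  and invariant conditions are measurable (closed, resp. clopen preimage);
* `measurable_sievePhi'`, `sievePhi_ae_eq` — the modification of `φ_p` by `0` on `{Δ = 0}` is
  measurable and a.e. equal to `φ_p`; hence **`φ_p` is a.e.-measurable** (`aemeasurable_sievePhi`),
  takes values in `[0, 1]` (`sievePhi_nonneg`, `sievePhi_le_one`) and is **integrable**
  (`integrable_sievePhi`).

## References

* M. Bhargava, A. Shankar, Ann. of Math. (2) 181 (2015) 191–242, §2.7 and proof of Thm 3.19 of the
  published version. [cite: BhargavaShankarAnnals2015, §2.7 and proof of Thm 3.19 (published numbering)]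
-/

noncomputable section

open scoped Classical Topology
open Filter Set MeasureTheory

namespace Literature.NumberTheory.EllipticCurves

namespace BinaryQuartic

variable (p : ℕ) [Fact p.Prime]

/-- `{Δ ≠ 0}` is open, hence measurable, in `V_{ℤ_p}`. [folklore] -/
theorem measurableSet_setOf_disc_ne_zero : MeasurableSet {f : BinaryQuartic ℤ_[p] | f.disc ≠ 0} :=
  (isOpen_ne_fun continuous_disc continuous_const).measurableSet

/-- **`m_p` is measurable** (as the function `f ↦ m_p(f)` on `{Δ ≠ 0}`, `0` on `{Δ = 0}`): its level
sets are open in `{Δ ≠ 0}`. [cite: BhargavaShankarAnnals2015, §3.2 and §2.7 (published numbering)] -/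
theorem measurable_ite_disc_localWeight :
    Measurable fun f : BinaryQuartic ℤ_[p] ↦ if f.disc ≠ 0 then localWeight f else 0 := by
  refine measurable_to_countable' fun m ↦ ?_
  by_cases hm : m = 0
  · -- the fibre over `0` is `{Δ = 0} ∪ {Δ ≠ 0, m_p = 0}`
    have : (fun f : BinaryQuartic ℤ_[p] ↦ if f.disc ≠ 0 then localWeight f else 0) ⁻¹' {m} =
        {f | f.disc = 0} ∪ {f | f.disc ≠ 0 ∧ localWeight f = 0} := by
      ext f
      simp only [mem_preimage, mem_singleton_iff, mem_union, mem_setOf_eq, hm]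
      by_cases h : f.disc = 0 <;> simp [h]
    rw [this]
    exact (isClosed_setOf_disc_eq_zero p).measurableSet.union
      (isOpen_setOf_disc_ne_zero_and_localWeight_eq 0).measurableSet
  · have : (fun f : BinaryQuartic ℤ_[p] ↦ if f.disc ≠ 0 then localWeight f else 0) ⁻¹' {m} =
        {f | f.disc ≠ 0 ∧ localWeight f = m} := by
      ext f
      simp only [mem_preimage, mem_singleton_iff, mem_setOf_eq]
      by_cases h : f.disc = 0
      · simp [h, Ne.symm hm]
      · simp [h]
    rw [this]
    exact (isOpen_setOf_disc_ne_zero_and_localWeight_eq m).measurableSet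

/-- The `ℚ_p`-soluble forms form a closed, hence measurable, subset of `V_{ℤ_p}`. [folklore] -/
theorem measurableSet_setOf_isSoluble :
    MeasurableSet {f : BinaryQuartic ℤ_[p] | (f.map PadicInt.Coe.ringHom).IsSoluble} :=
  isClosed_setOf_isSoluble.measurableSet

/-- The invariant condition `(I(f), J(f)) ∈ 2⁴F_p^{inv} × 2⁶F_p^{inv}` defines a clopen, hence
measurable, subset of `V_{ℤ_p}`. [cite: BhargavaShankarAnnals2015, proof of Thm 3.19 (published numbering)] -/
theorem measurableSet_setOf_exists_invariantPairsAdic :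
    MeasurableSet {f : BinaryQuartic ℤ_[p] | ∃ IJ ∈ invariantPairsAdic p, f.I = 2 ^ 4 * IJ.1 ∧ f.J = 2 ^ 6 * IJ.2} := by
  have key : {f : BinaryQuartic ℤ_[p] | ∃ IJ ∈ invariantPairsAdic p, f.I = 2 ^ 4 * IJ.1 ∧ f.J = 2 ^ 6 * IJ.2} =
      (fun g : BinaryQuartic ℤ_[p] ↦ (g.I, g.J)) ⁻¹'
        ((fun IJ : ℤ_[p] × ℤ_[p] ↦ ((2 : ℤ_[p]) ^ 4 * IJ.1, (2 : ℤ_[p]) ^ 6 * IJ.2)) '' invariantPairsAdic p) := by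
    ext g
    simp only [mem_setOf_eq, mem_preimage, mem_image, Prod.mk.injEq]
    constructor
    · rintro ⟨IJ, hIJ, h1, h2⟩; exact ⟨IJ, hIJ, h1.symm, h2.symm⟩
    · rintro ⟨IJ, hIJ, h1, h2⟩; exact ⟨IJ, hIJ, h1.symm, h2.symm⟩
  rw [key]
  have hcont : Continuous fun g : BinaryQuartic ℤ_[p] ↦ (g.I, g.J) := by fun_prop
  exact ((isClopen_image_invariantPairsAdic p).isOpen.preimage hcont).measurableSet

/-- **The modified weight `φ'_p` (`= φ_p` off `Δ = 0`, `= 0` on `Δ = 0`) is measurable.**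
[cite: BhargavaShankarAnnals2015, §2.7 and proof of Thm 3.19 (published numbering)] -/
theorem measurable_sievePhi' :
    Measurable fun f : BinaryQuartic ℤ_[p] ↦
      if f.disc ≠ 0 ∧ (f.map PadicInt.Coe.ringHom).IsSoluble ∧
          (∃ IJ ∈ invariantPairsAdic p, f.I = 2 ^ 4 * IJ.1 ∧ f.J = 2 ^ 6 * IJ.2)
        then (1 : ℝ) / (if f.disc ≠ 0 then localWeight f else 0 : ℕ) else 0 := by
  refine Measurable.ite ?_ ?_ measurable_const
  · exact (measurableSet_setOf_disc_ne_zero p).inter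
      ((measurableSet_setOf_isSoluble p).inter (measurableSet_setOf_exists_invariantPairsAdic p))
  · exact measurable_const.div ((measurable_from_nat (f := fun n : ℕ ↦ (n : ℝ))).comp (measurable_ite_disc_localWeight p))

/-- `φ_p` and its modification agree off `{Δ = 0}`, a null set: `φ_p = φ'_p` a.e.
[cite: BhargavaShankarAnnals2015, §2.7 (published numbering)] -/
theorem sievePhi_ae_eq :
    (fun f : BinaryQuartic ℤ_[p] ↦
      if (f.map PadicInt.Coe.ringHom).IsSoluble ∧
          (∃ IJ ∈ invariantPairsAdic p, f.I = 2 ^ 4 * IJ.1 ∧ f.J = 2 ^ 6 * IJ.2)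
        then (1 : ℝ) / localWeight f else 0) =ᵐ[volume]
    (fun f : BinaryQuartic ℤ_[p] ↦
      if f.disc ≠ 0 ∧ (f.map PadicInt.Coe.ringHom).IsSoluble ∧
          (∃ IJ ∈ invariantPairsAdic p, f.I = 2 ^ 4 * IJ.1 ∧ f.J = 2 ^ 6 * IJ.2)
        then (1 : ℝ) / (if f.disc ≠ 0 then localWeight f else 0 : ℕ) else 0) := by
  filter_upwards [ae_disc_ne_zero (R := ℤ_[p])] with f hf
  simp only [hf, ne_eq, not_false_eq_true, true_and, if_true]

/-- **`φ_p` is a.e.-measurable on `V_{ℤ_p}`.** [cite: BhargavaShankarAnnals2015, §2.7 and proof of Thm 3.19 (published numbering)] -/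
theorem aemeasurable_sievePhi :
    AEMeasurable (fun f : BinaryQuartic ℤ_[p] ↦
      if (f.map PadicInt.Coe.ringHom).IsSoluble ∧
          (∃ IJ ∈ invariantPairsAdic p, f.I = 2 ^ 4 * IJ.1 ∧ f.J = 2 ^ 6 * IJ.2)
        then (1 : ℝ) / localWeight f else 0) volume :=
  ⟨_, measurable_sievePhi' p, sievePhi_ae_eq p⟩

/-- `0 ≤ φ_p ≤ 1`. [folklore] -/
theorem sievePhi_nonneg_le_one (f : BinaryQuartic ℤ_[p]) :
    0 ≤ (if (f.map PadicInt.Coe.ringHom).IsSoluble ∧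
          (∃ IJ ∈ invariantPairsAdic p, f.I = 2 ^ 4 * IJ.1 ∧ f.J = 2 ^ 6 * IJ.2)
        then (1 : ℝ) / localWeight f else 0) ∧
    (if (f.map PadicInt.Coe.ringHom).IsSoluble ∧
          (∃ IJ ∈ invariantPairsAdic p, f.I = 2 ^ 4 * IJ.1 ∧ f.J = 2 ^ 6 * IJ.2)
        then (1 : ℝ) / localWeight f else 0) ≤ 1 := by
  split_ifs
  · refine ⟨by positivity, ?_⟩
    rcases Nat.eq_zero_or_pos (localWeight f) with h0 | hpos
    · simp [h0]
    · rw [div_le_one (by exact_mod_cast hpos)]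
      exact_mod_cast hpos
  · exact ⟨le_rfl, zero_le_one⟩

/-- **`φ_p` is integrable on `V_{ℤ_p}`** (bounded by `1`, a.e.-measurable, finite measure).
[cite: BhargavaShankarAnnals2015, §2.7 and proof of Thm 3.19 (published numbering)] -/
theorem integrable_sievePhi :
    Integrable (fun f : BinaryQuartic ℤ_[p] ↦
      if (f.map PadicInt.Coe.ringHom).IsSoluble ∧
          (∃ IJ ∈ invariantPairsAdic p, f.I = 2 ^ 4 * IJ.1 ∧ f.J = 2 ^ 6 * IJ.2)
        then (1 : ℝ) / localWeight f else 0) volume := by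
  refine Integrable.of_bound (aemeasurable_sievePhi p).aestronglyMeasurable 1 (Eventually.of_forall fun f ↦ ?_)
  obtain ⟨h0, h1⟩ := sievePhi_nonneg_le_one p f
  rw [Real.norm_eq_abs, abs_of_nonneg h0]
  exact h1

end BinaryQuartic

end Literature.NumberTheory.EllipticCurves

end
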